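import Mathlib
import Summits.ResolutionOfSingularities.ResolutionOfSingularities.Theorems.CleanModels.Negative.CossartPiltant2019Thm15iFrameFalseOfCurveBlowupFacts
import Literature.AlgebraicGeometry.Resolution.RegularCentreRsopPart
import Literature.AlgebraicGeometry.Resolution.RegularSystemOfParameters
import HarnessLib

/-!
# Towards `CurveBlowupFacts 5`: the first tower member as a regular local ring, and the centre of a curve blow-up

Support file (INPUTS seat res-inputs-p-cp15frame g2, 2026-08-28) for the discharge of the residual hypothesis
`CurveBlowupFacts 5` of `CossartPiltant2019_thm_1_5_i_frame_false_of_curveBlowupFacts`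
(`CossartPiltant2019Thm15iFrameFalseOfCurveBlowupFacts.lean`; RETIRED statement F-110, crux `CleanModels`,
stmt-ResolutionOfSingularities-15917).  A curve blow-up `B♯` (`OrdWitness.IsCurveBlowup`) is the local blowing up, with
respect to `O = ord_𝔪`, of `R = range (S → K)` (`S = 𝔽_p[X₀,X₁,X₂]_{(X)}`) along a centre `P` with regular quotient which is
neither the closed point nor principal.  This file sets up the commutative algebra of `R` needed to analyse `B♯` with the
tree's theory of regular systems of parameters (`RegularSystemOfParameters.lean`, `RsopMonomialIdeals.lean`,
`RegularCentreRsopPart.lean`):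

* `OrdWitness.Rg p = range (S → K)` with `OrdWitness.rangeEquiv : S ≃+* Rg`; `Rg` is a regular local ring of dimension `3`
  and embedding dimension `3` (transport);
* the DICTIONARY between powers of the maximal ideal of `Rg` and the order valuation:
  `y ∈ 𝔪ⁿ ⟺ ordVK y ≤ exp (−n)` (`ordVK_le_expNeg_of_mem_pow`, `mem_pow_of_ordVK_le_expNeg`);
* `OrdWitness.exists_rsop_of_curveCentre` — **the centre of a curve blow-up is `P = (u₀, v)` with `(u₀, v, w)` a regular
  system of parameters of `Rg` and `u₀` the chart generator** (Matsumura 14.2 via `exists_isRsopPart_span_range_eq` and the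
  dimension formula `dim R/P + r = dim R`: `r = 2` because `P` is neither principal (`r ≠ 0, 1`) nor the closed point
  (`r ≠ 3`); `u₀` has order `1`, so one of its coefficients on `(c₀, c₁)` is a unit and `u₀` replaces that generator);
* `OrdWitness.closure_div_eq_closure_pair` — the blown-up algebra `R[u/u₀]` is `R[v/u₀]`.

Nothing here proves or refutes resolution of singularities in characteristic `p`; [OURS · NEGATIVE-SUPPORT] counted 0.
-/

noncomputable section

set_option linter.dupNamespace false -- mandated namespace of this single-conjunct summit

open MvPolynomial IsLocalRing
open Literature.AlgebraicGeometry.Resolution Literature.AlgebraicGeometry.Resolution.WeightedBlowup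

namespace Summit.ResolutionOfSingularities.ResolutionOfSingularities.Theorems.CleanModels.Negative

namespace OrdWitness

variable (p : ℕ) [hp : Fact p.Prime]

/-! ## 1. `R = range (S → K)` is a regular local ring of dimension `3` -/

/-- `Rg = range (S → K)`, the first member of every F-110 tower along `ord_𝔪`, as a subring of `K`. [folklore] -/
abbrev Rg : Subring (K p) := (algebraMap (S p) (K p)).range

/-- `S ≃ range (S → K)` (`S → K` is injective). [folklore] -/
def rangeEquiv : S p ≃+* Rg p :=
  RingEquiv.ofBijective (algebraMap (S p) (K p)).rangeRestrict
    ⟨fun _ _ h => IsFractionRing.injective (S p) (K p) (congrArg Subtype.val h),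
      RingHom.rangeRestrict_surjective _⟩

/-- `rangeEquiv s = s` in `K`. [folklore] -/
theorem coe_rangeEquiv (s : S p) : ((rangeEquiv p s : Rg p) : K p) = algebraMap (S p) (K p) s := rfl

/-- `range (S → K)` is a regular local ring. [folklore] -/
instance isRegularLocalRing_range : IsRegularLocalRing (Rg p) :=
  IsRegularLocalRing.of_ringEquiv (rangeEquiv p)

/-- `dim range (S → K) = 3`. [folklore] -/
theorem ringKrullDim_range : ringKrullDim (Rg p) = 3 := by
  rw [← ringKrullDim_eq_of_ringEquiv (rangeEquiv p), ringKrullDim_S]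

/-- `emb dim range (S → K) = 3`. [folklore] -/
theorem spanFinrank_maximalIdeal_range : (maximalIdeal (Rg p)).spanFinrank = 3 := by
  have h := IsRegularLocalRing.spanFinrank_maximalIdeal (R := Rg p)
  rw [ringKrullDim_range] at h
  exact_mod_cast h

/-! ## 2. The dictionary `𝔪ⁿ ↔ ord ≥ n` on `range (S → K)` -/

/-- Domination: `y ∈ 𝔪_R ⟺ ordVK y < 1`. [folklore] -/
theorem mem_maximalIdeal_range_iff (y : Rg p) : y ∈ maximalIdeal (Rg p) ↔ ordVK p (y : K p) < 1 := by
  rw [mem_maximalIdeal_iff_valuation_lt_one (range_le_O p) (locAtCentre_range_eq p) y, valuation_O_lt_one_iff]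

/-- Elements of `range (S → K)` have value `≤ 1`. [folklore] -/
theorem ordVK_range_le_one (y : Rg p) : ordVK p (y : K p) ≤ 1 := (mem_O_iff p _).mp (range_le_O p y.2)

omit hp in
/-- Discreteness of `ℤᵐ⁰`: `v < 1 ⟺ v ≤ exp (−1)`. [folklore] -/
theorem lt_one_iff_le_expNeg_one {v : WithZero (Multiplicative ℤ)} : v < 1 ↔ v ≤ expNeg 1 := by
  rcases eq_or_ne v 0 with rfl | hv
  · exact ⟨fun _ => zero_le, fun _ => zero_lt_one⟩
  obtain ⟨z, rfl⟩ := WithZero.ne_zero_iff_exists.mp hv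
  rw [expNeg, WithZero.coe_le_coe, ← WithZero.coe_one, WithZero.coe_lt_coe, ← Multiplicative.toAdd_lt,
    ← Multiplicative.toAdd_le, toAdd_one, toAdd_ofAdd]
  push_cast
  omega

/-- **`y ∈ 𝔪ⁿ ⟹ ordVK y ≤ exp (−n)`.** [folklore] -/
theorem ordVK_le_expNeg_of_mem_pow {y : Rg p} {n : ℕ} (h : y ∈ maximalIdeal (Rg p) ^ n) :
    ordVK p (y : K p) ≤ expNeg n := by
  -- the ideals `J n = {y | ordVK y ≤ exp (−n)}`
  let J : ℕ → Ideal (Rg p) := fun n =>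
    { carrier := {y | ordVK p (y : K p) ≤ expNeg n}
      add_mem' := fun {a b} ha hb => by
        show ordVK p ((a + b : Rg p) : K p) ≤ expNeg n
        rw [Subring.coe_add]
        exact (Valuation.map_add _ _ _).trans (max_le ha hb)
      zero_mem' := by
        show ordVK p ((0 : Rg p) : K p) ≤ expNeg n
        rw [Subring.coe_zero, map_zero]; exact zero_le
      smul_mem' := fun c {a} ha => by
        show ordVK p ((c • a : Rg p) : K p) ≤ expNeg n
        rw [smul_eq_mul, Subring.coe_mul, map_mul]
        calc ordVK p (c : K p) * ordVK p (a : K p) ≤ 1 * expNeg n := mul_le_mul' (ordVK_range_le_one p c) ha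
          _ = expNeg n := one_mul _ }
  have hJ : ∀ n (y : Rg p), y ∈ J n ↔ ordVK p (y : K p) ≤ expNeg n := fun n y => Iff.rfl
  have hJ1 : maximalIdeal (Rg p) ≤ J 1 := fun y hy =>
    (hJ 1 y).mpr (lt_one_iff_le_expNeg_one.mp ((mem_maximalIdeal_range_iff p y).mp hy))
  have hJmul : ∀ m n, J m * J n ≤ J (m + n) := by
    intro m n
    rw [Ideal.mul_le]
    intro r hr s hs
    rw [hJ] at hr hs ⊢
    rw [Subring.coe_mul, map_mul, expNeg_add]
    exact mul_le_mul' hr hs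
  have hJpow : ∀ n, maximalIdeal (Rg p) ^ n ≤ J n := by
    intro n
    induction n with
    | zero =>
      intro y _
      rw [hJ, expNeg_zero]
      exact ordVK_range_le_one p y
    | succ m ih => rw [pow_succ]; exact (Ideal.mul_mono ih hJ1).trans (hJmul m 1)
  exact (hJ n y).mp (hJpow n h)

/-- **`ordVK y ≤ exp (−n) ⟹ y ∈ 𝔪ⁿ`** (`y = a/w`, `ord a ≥ n` puts `a ∈ (X)ⁿ`, whose image lies in `𝔪ⁿ`, and `1/w ∈ R`).
[folklore] -/
theorem mem_pow_of_ordVK_le_expNeg {y : Rg p} {n : ℕ} (h : ordVK p (y : K p) ≤ expNeg n) :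
    y ∈ maximalIdeal (Rg p) ^ n := by
  obtain ⟨s, hs⟩ := y.2
  obtain ⟨⟨a, w⟩, hs'⟩ := IsLocalization.mk'_surjective (origin p).primeCompl s
  change IsLocalization.mk' (S p) a w = s at hs'
  have hyK : algebraMap (S p) (K p) (IsLocalization.mk' (S p) a w) = (y : K p) := by rw [hs', hs]
  have hyv : ordVK p (y : K p) = ordV p a := by rw [← hyK]; exact ordVK_mk' p a w
  by_cases ha0 : a = 0
  · have : y = 0 := by
      apply Subtype.ext
      rw [← hyK, ha0, IsLocalization.mk'_zero, map_zero]
      rfl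
    rw [this]; exact zero_mem _
  have han : a ∈ origin p ^ n := (ordV_le_expNeg_iff p ha0 n).mp (hyv ▸ h)
  have hmap : Ideal.map (toRange p) (origin p ^ n) ≤ maximalIdeal (Rg p) ^ n := by
    rw [Ideal.map_pow]
    exact Ideal.pow_right_mono
      (Ideal.map_le_iff_le_comap.mpr fun x hx => Ideal.mem_comap.mpr (toRange_mem_maximalIdeal p hx)) n
  have hta : toRange p a ∈ maximalIdeal (Rg p) ^ n := hmap (Ideal.mem_map_of_mem _ han)
  have hw1 : ordV p (w : Poly p) = 1 := ordV_eq_one_of_not_mem p w.2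
  have hw0 : algebraMap (Poly p) (K p) w ≠ 0 := by
    intro e
    have := ordVK_algebraMap p (w : Poly p)
    rw [e, map_zero, hw1] at this
    exact zero_ne_one this
  have hwinv : (algebraMap (Poly p) (K p) w)⁻¹ ∈ Rg p := by
    refine ⟨IsLocalization.mk' (S p) 1 w, ?_⟩
    have h1 := algebraMap_mk'_mul p 1 w
    rw [map_one] at h1
    exact eq_inv_of_mul_eq_one_left h1
  have e : y = toRange p a * ⟨(algebraMap (Poly p) (K p) w)⁻¹, hwinv⟩ := by
    apply Subtype.ext
    show (y : K p) = ((toRange p a : Rg p) : K p) * (algebraMap (Poly p) (K p) w)⁻¹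
    rw [coe_toRange, ← hyK, eq_mul_inv_iff_mul_eq₀ hw0, algebraMap_mk'_mul]
  rw [e]
  exact Ideal.mul_mem_right _ _ hta

/-- `ordVK y ≤ exp (−n) ⟺ y ∈ 𝔪ⁿ` on `range (S → K)`. [folklore] -/
theorem ordVK_le_expNeg_iff_mem_pow (y : Rg p) (n : ℕ) :
    ordVK p (y : K p) ≤ expNeg n ↔ y ∈ maximalIdeal (Rg p) ^ n :=
  ⟨mem_pow_of_ordVK_le_expNeg p, ordVK_le_expNeg_of_mem_pow p⟩

/-- A regular parameter of `range (S → K)` has order exactly `1`. [folklore] -/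
theorem ordVK_eq_expNeg_one_of_not_mem_sq {t : Rg p} (ht : t ∈ maximalIdeal (Rg p))
    (ht2 : t ∉ maximalIdeal (Rg p) ^ 2) : ordVK p (t : K p) = expNeg 1 :=
  ordVK_eq_expNeg_one_of_kindS p (Rg p) rfl t ht ht2

/-! ## 3. The centre of a curve blow-up -/

/-- `{y 0}` is the range of `y : Fin 1 → R`. [folklore] -/
theorem range_fin_one {α : Type*} (y : Fin 1 → α) : Set.range y = {y 0} := by
  ext a
  simp only [Set.mem_range, Fin.exists_fin_one, Set.mem_singleton_iff, eq_comm]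

/-- **The centre of a curve blow-up is `(u₀, v)` with `(u₀, v, w)` a regular system of parameters.**  Let `P ⊂ R = range (S → K)`
have regular quotient, miss some non-unit, be non-principal and be generated by a finite set `u ∋ u₀` whose members have value
at most that of `u₀ ≠ 0`.  Then `P = (u₀, v)` and `𝔪_R = (u₀, v, w)` for some `v, w`.  (Matsumura 14.2: `P = (c₁,…,c_r)` with `c`
part of a regular system of parameters and `dim R/P + r = 3`; `r ≠ 0, 1` as `P` is not principal, `r ≠ 3` as `P` is not the closed
point; `u₀ ∈ P ∖ 𝔪²` because it has the least order among generators, so `u₀` can replace one of `c₀, c₁`.) [folklore] -/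
theorem exists_rsop_of_curveCentre {P : Ideal (Rg p)} (hRP : IsRegularLocalRing (Rg p ⧸ P))
    (hx : ∃ x : Rg p, ¬ IsUnit x ∧ x ∉ P) (hnp : ∀ π : Rg p, P ≠ Ideal.span {π})
    {u : Finset (Rg p)} {u₀ : Rg p} (hspan : Ideal.span (↑u : Set (Rg p)) = P) (hu₀ : u₀ ∈ u) (hne : u₀ ≠ 0)
    (hval : ∀ x ∈ u, (O p).valuation (x : K p) ≤ (O p).valuation (u₀ : K p)) :
    ∃ x : Fin 3 → Rg p, x 0 = u₀ ∧ Ideal.span (Set.range x) = maximalIdeal (Rg p) ∧ Ideal.span {x 0, x 1} = P := by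
  classical
  haveI := hRP
  -- (small range computations, kept local: the tree has them under unrelated imports)
  have range_fin_two : ∀ c : Fin 2 → Rg p, Set.range c = {c 0, c 1} := fun c => by
    ext a
    simp only [Set.mem_range, Fin.exists_fin_two, Set.mem_insert_iff, Set.mem_singleton_iff, eq_comm]
  have range_vec3 : ∀ a b c : Rg p, Set.range ![a, b, c] = {a, b, c} := fun a b c => by
    ext t
    simp only [Set.mem_range, Fin.exists_fin_succ, Matrix.cons_val_zero, Matrix.cons_val_succ,
      Set.mem_insert_iff, Set.mem_singleton_iff, eq_comm]
    simp
  have hPtop : P ≠ ⊤ := by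
    intro h
    haveI : Subsingleton (Rg p ⧸ P) := Ideal.Quotient.subsingleton_iff.mpr h
    exact false_of_nontrivial_of_subsingleton (Rg p ⧸ P)
  have hPle : P ≤ maximalIdeal (Rg p) := IsLocalRing.le_maximalIdeal hPtop
  have hu₀P : u₀ ∈ P := hspan ▸ Ideal.subset_span hu₀
  obtain ⟨r, c, hc, hcP⟩ := exists_isRsopPart_span_range_eq hPle
  -- `r = 2`
  have hdim := hc.ringKrullDim_quotient_add
  rw [hcP, ringKrullDim_range] at hdim
  obtain ⟨k, hk⟩ := exists_nat_cast_eq_ringKrullDim (R := Rg p ⧸ P)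
  rw [hk] at hdim
  have hkr : k + r = 3 := by
    have : ((k + r : ℕ) : WithBot ℕ∞) = ((3 : ℕ) : WithBot ℕ∞) := by push_cast; exact hdim
    exact_mod_cast this
  have hr0 : r ≠ 0 := by
    rintro rfl
    have hbot : P = ⊥ := by rw [← hcP, Set.range_eq_empty, Ideal.span_empty]
    rw [hbot, Ideal.mem_bot] at hu₀P
    exact hne hu₀P
  have hr1 : r ≠ 1 := by
    rintro rfl
    apply hnp (c 0)
    rw [← hcP, range_fin_one]
  have hr3 : r ≠ 3 := by
    rintro rfl
    have hk0 : k = 0 := by omega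
    have hfield : IsField (Rg p ⧸ P) := by
      rw [IsLocalRing.isField_iff_maximalIdeal_eq]
      have h1 := IsRegularLocalRing.spanFinrank_maximalIdeal (R := Rg p ⧸ P)
      rw [hk, hk0] at h1
      have h2 : (maximalIdeal (Rg p ⧸ P)).spanFinrank = 0 := by exact_mod_cast h1
      exact (Submodule.spanFinrank_eq_zero_iff_eq_bot (maximalIdeal (Rg p ⧸ P)).fg_of_isNoetherianRing).mp h2
    have hPmax : P = maximalIdeal (Rg p) := IsLocalRing.eq_maximalIdeal (Ideal.Quotient.maximal_of_isField P hfield)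
    obtain ⟨x, hxu, hxP⟩ := hx
    exact hxP (hPmax ▸ (IsLocalRing.mem_maximalIdeal x).mpr hxu)
  obtain rfl : r = 2 := by omega
  -- the full regular system of parameters `(c 0, c 1, y 0)`
  obtain ⟨-, e, y, hdim2, hspan2⟩ := hc
  rw [ringKrullDim_range] at hdim2
  obtain rfl : e = 1 := by
    have : ((3 : ℕ) : WithBot ℕ∞) = ((2 + e : ℕ) : WithBot ℕ∞) := by push_cast; exact_mod_cast hdim2
    have := (Nat.cast_inj (R := WithBot ℕ∞)).mp this
    omega
  rw [range_fin_two, range_fin_one] at hspan2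
  rw [range_fin_two] at hcP
  have hcI : IsRsopPart c := ⟨inferInstance, 1, y, by rw [ringKrullDim_range]; rfl,
    by rw [range_fin_two, range_fin_one]; exact hspan2⟩
  -- orders: `ord (c 0) = 1 = ord u₀`
  have hequiv := Valuation.isEquiv_valuation_valuationSubring (ordVK p)
  have hc0 : ordVK p (c 0 : K p) = expNeg 1 :=
    ordVK_eq_expNeg_one_of_not_mem_sq p (hcI.mem_maximalIdeal 0) (hcI.not_mem_sq 0)
  have hu₀1 : ordVK p (u₀ : K p) = expNeg 1 := by
    apply eq_expNeg_one_of_le_of_lt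
    · rw [← hc0]
      have hc0P : c 0 ∈ Ideal.span (↑u : Set (Rg p)) := by
        rw [hspan, ← hcP]; exact Ideal.subset_span (Set.mem_insert _ _)
      exact (hequiv.le_iff_le).mpr (valuation_span_le p (range_le_O p) hval hc0P).1
    · exact (mem_maximalIdeal_range_iff p u₀).mp (hPle hu₀P)
  -- `u₀ = α c₀ + β c₁` with `α` or `β` a unit
  have hu₀cc : u₀ ∈ Ideal.span {c 0, c 1} := hcP ▸ hu₀P
  obtain ⟨α, β, hαβ⟩ := Ideal.mem_span_pair.mp hu₀cc
  have hunit : IsUnit α ∨ IsUnit β := by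
    by_contra hcon
    push Not at hcon
    have hαm : α ∈ maximalIdeal (Rg p) := (IsLocalRing.mem_maximalIdeal α).mpr hcon.1
    have hβm : β ∈ maximalIdeal (Rg p) := (IsLocalRing.mem_maximalIdeal β).mpr hcon.2
    have hsq : u₀ ∈ maximalIdeal (Rg p) ^ 2 := by
      rw [← hαβ, pow_two]
      exact Ideal.add_mem _ (Ideal.mul_mem_mul hαm (hcI.mem_maximalIdeal 0))
        (Ideal.mul_mem_mul hβm (hcI.mem_maximalIdeal 1))
    have := ordVK_le_expNeg_of_mem_pow p hsq
    rw [hu₀1, expNeg_le_expNeg] at this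
    omega
  -- the two cases
  have hm3 : maximalIdeal (Rg p) = Ideal.span {c 0, c 1} ⊔ Ideal.span {y 0} := by
    rw [← hspan2, ← Ideal.span_union]
  rcases hunit with ⟨αu, hαu⟩ | ⟨βu, hβu⟩
  · -- `α` a unit: replace `c 0` by `u₀`
    have hpair : Ideal.span {u₀, c 1} = Ideal.span {c 0, c 1} := by
      apply le_antisymm
      · rw [Ideal.span_le]
        rintro t (rfl | rfl)
        · exact hu₀cc
        · exact Ideal.subset_span (Set.mem_insert_of_mem _ rfl)
      · rw [Ideal.span_le]
        rintro t (rfl | rfl)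
        · refine Ideal.mem_span_pair.mpr ⟨(↑αu⁻¹ : Rg p), -((↑αu⁻¹ : Rg p) * β), ?_⟩
          rw [← hαβ, ← hαu]
          linear_combination (c 0) * αu.inv_mul
        · exact Ideal.subset_span (Set.mem_insert_of_mem _ rfl)
    refine ⟨![u₀, c 1, y 0], rfl, ?_, ?_⟩
    · rw [range_vec3, hm3, ← hpair]
      rw [Ideal.span_insert, Ideal.span_insert, Ideal.span_insert, sup_assoc]
    · change Ideal.span {u₀, c 1} = P
      rw [hpair, hcP]
  · -- `β` a unit: replace `c 1` by `u₀`
    have hpair : Ideal.span {u₀, c 0} = Ideal.span {c 0, c 1} := by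
      apply le_antisymm
      · rw [Ideal.span_le]
        rintro t (rfl | rfl)
        · exact hu₀cc
        · exact Ideal.subset_span (Set.mem_insert _ _)
      · rw [Ideal.span_le]
        rintro t (rfl | rfl)
        · exact Ideal.subset_span (Set.mem_insert_of_mem _ rfl)
        · refine Ideal.mem_span_pair.mpr ⟨(↑βu⁻¹ : Rg p), -((↑βu⁻¹ : Rg p) * α), ?_⟩
          rw [← hαβ, ← hβu]
          linear_combination (c 1) * βu.inv_mul
    refine ⟨![u₀, c 0, y 0], rfl, ?_, ?_⟩
    · rw [range_vec3, hm3, ← hpair]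
      rw [Ideal.span_insert, Ideal.span_insert, Ideal.span_insert, sup_assoc]
    · change Ideal.span {u₀, c 0} = P
      rw [hpair, hcP]

/-- For `y` in the ideal spanned by the chart generators `u`, `y/u₀` lies in the blown-up algebra `R[u/u₀]`. [folklore] -/
theorem div_mem_closure_of_mem_span {L : Type} [Field L] {B : Subring L} {u : Finset B} {u₀ : B} {y : B}
    (hy : y ∈ Ideal.span (↑u : Set B)) :
    (y : L) / u₀ ∈ Subring.closure ((B : Set L) ∪ (fun x : B => (x : L) / u₀) '' ↑u) := by
  set C := Subring.closure ((B : Set L) ∪ (fun x : B => (x : L) / u₀) '' ↑u)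
  induction hy using Submodule.span_induction with
  | mem x hx => exact Subring.subset_closure (Or.inr ⟨x, hx, rfl⟩)
  | zero => simp
  | add x y _ _ hx hy => rw [Subring.coe_add, add_div]; exact C.add_mem hx hy
  | smul a x _ hx =>
    rw [smul_eq_mul, Subring.coe_mul, mul_div_assoc]
    exact C.mul_mem (Subring.subset_closure (Or.inl a.2)) hx

/-- **The blown-up algebra of a curve centre is `R[v/u₀]`**: if `P = span u = (u₀, v)` then `R[x/u₀ : x ∈ u] = R[v/u₀]` inside `K`.
[folklore] -/
theorem closure_div_eq_closure_singleton {L : Type} [Field L] {B : Subring L} {u : Finset B} {u₀ v : B} {P : Ideal B}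
    (hspan : Ideal.span (↑u : Set B) = P) (hP : Ideal.span {u₀, v} = P) (hne : (u₀ : L) ≠ 0) :
    Subring.closure ((B : Set L) ∪ (fun x : B => (x : L) / u₀) '' ↑u) = Subring.closure ((B : Set L) ∪ {(v : L) / u₀}) := by
  apply le_antisymm
  · refine Subring.closure_le.mpr (Set.union_subset (fun b hb => Subring.subset_closure (Or.inl hb)) ?_)
    rintro _ ⟨x, hx, rfl⟩
    have hxP : x ∈ Ideal.span {u₀, v} := by rw [hP, ← hspan]; exact Ideal.subset_span hx
    obtain ⟨a, b, hab⟩ := Ideal.mem_span_pair.mp hxP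
    have e : ((x : B) : L) / u₀ = (a : L) + (b : L) * ((v : L) / u₀) := by
      rw [← hab, Subring.coe_add, Subring.coe_mul, Subring.coe_mul]
      field_simp
    show ((x : B) : L) / u₀ ∈ Subring.closure ((B : Set L) ∪ {(v : L) / u₀})
    rw [e]
    exact Subring.add_mem _ (Subring.subset_closure (Or.inl a.2))
      (Subring.mul_mem _ (Subring.subset_closure (Or.inl b.2)) (Subring.subset_closure (Or.inr rfl)))
  · refine Subring.closure_le.mpr (Set.union_subset (fun b hb => Subring.subset_closure (Or.inl hb)) ?_)
    rintro _ rfl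
    have hvP : v ∈ Ideal.span (↑u : Set B) := by rw [hspan, ← hP]; exact Ideal.subset_span (Set.mem_insert_of_mem _ rfl)
    exact div_mem_closure_of_mem_span hvP

end OrdWitness

end Summit.ResolutionOfSingularities.ResolutionOfSingularities.Theorems.CleanModels.Negative

end
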